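import Summits.QuantumFields.YangMills.Theorems.FemtoTransferGapSpectralSumsTails
import HarnessLib

/-!
# DRESSED RAYLEIGH BUDGETS from spectral data (pure real sequences; F9-II for S-PSCAL″ of crux `DressedRitz`, stmt-QuantumFields-20205, line «polyakovlift» r6;
# LEAD prover ym-lead-20205-polyakovlift g2)

The one-site clauses (o5′)(o6′) of S-PSCAL″ concern `N = ‖K^n v‖² = Σ_k λ_k^{2n} a_k²` and `D = ⟨K^n v, K^{n+1} v⟩ = Σ_k λ_k^{2n+1} a_k²` (tree
`FemtoTransferGapSpectralSums`), `a_k = ⟨v, e_k⟩`, `λ_k` antitone non-negative.  Given a CLUSTER of indices `[m₁, m₂)` containing the target level `j₀`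
(`λ_c := λ_{j₀}`, intra-cluster spread `≤ σ`), this file bounds the position defect `D − λ_c N` from BOTH sides by three budgets of the UNDRESSED vector:
the lower mass `lo = Σ_{k<m₁} a_k²`, the in-cluster mass `in = Σ_{m₁≤k<m₂} a_k²`, and the signed first-moment slop `E = λ_c‖v‖² − ⟨v,Kv⟩`
(`‖v‖² ≥ Σ a_k²` Bessel, `⟨v,Kv⟩ = Σ λ_k a_k²`):

* ★ `dressed_upper`:  `D − λ_c N ≤ λ_0^{2n}(λ_0 − λ_c)·lo + λ_{m₁}^{2n}·σ·in`  (terms beyond the cluster are ≤ 0);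
* ★ `dressed_lower`:  `λ_c N − D ≤ λ_{m₁}^{2n}·σ·in + λ_{m₂}^{2n}·(E + (λ_0 − λ_c)·lo + σ·in)`  (dressed energy tail ≤ λ_{m₂}^{2n} × undressed energy tail);
* `dressed_norm_lower`: `λ_low^{2n}·in ≤ N` (`λ_low ≤ λ_k` on the cluster); `dressed_norm_upper`: `N ≤ λ_0^{2n}‖v‖²`;
* ★ `dressed_cross`: for two vectors and a pivot `κ ≥ λ_M`:
  `|D_{ab} − κN_{ab} − Σ_{k<M} λ_k^{2n}(λ_k − κ)a_kb_k| ≤ λ_M^{2n}·(t·T_a + T_b/t)/2`, `T_a ≤ (κ‖v‖² − ⟨v,Kv⟩) + Σ_{k<M}(λ_k − κ)a_k²`.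

HONEST FRAMING: real-analysis plumbing; nothing here bears on infinite volume, the continuum limit or the Clay gap.
References: Reed–Simon IV, Thm. XIII.1 [cite: ReedSimonIV1978, Thm. XIII.1]; M. Lüscher, NPB 219 (1983) 233 [cite: Luscher1983, §3].
-/

set_option autoImplicit false

noncomputable section

open Finset
open scoped BigOperators

namespace Summit.QuantumFields.YangMills.Theorems.FemtoTransferGap.SpecSum

variable {lam a b : ℕ → ℝ}

/-! ## §1 Diagonal budgets -/

/-- Reindex a `HasSum` of `λ^p · (w · a²)` as `λ^p w a²` bookkeeping: `λ_k^{p+1} a_k² = λ_k^p (λ_k a_k²)`. [folklore] -/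
theorem hasSum_pow_succ_mul {p : ℕ} {S : ℝ} (h : HasSum (fun k => lam k ^ (p + 1) * a k ^ 2) S) :
    HasSum (fun k => lam k ^ p * (lam k * a k ^ 2)) S :=
  h.congr_fun fun k => by ring

/-- ★ **Upper position budget.**  `D − λ_c N ≤ λ_0^{2n}(λ_0 − λ_c)·lo + λ_{m₁}^{2n}·σ·in`. [cite: ReedSimonIV1978, Thm. XIII.1] -/
theorem dressed_upper (hanti : Antitone lam) (hnn : ∀ k, 0 ≤ lam k) (n : ℕ) {m₁ m₂ j₀ : ℕ} (h1 : m₁ ≤ j₀) (h2 : j₀ < m₂)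
    {σ : ℝ} (hσ : ∀ k, m₁ ≤ k → k < m₂ → |lam k - lam j₀| ≤ σ) {N D : ℝ}
    (hN : HasSum (fun k => lam k ^ (2 * n) * a k ^ 2) N) (hD : HasSum (fun k => lam k ^ (2 * n + 1) * a k ^ 2) D) :
    D - lam j₀ * N ≤ lam 0 ^ (2 * n) * (lam 0 - lam j₀) * ∑ k ∈ range m₁, a k ^ 2 +
      lam m₁ ^ (2 * n) * σ * ∑ k ∈ Ico m₁ m₂, a k ^ 2 := by
  -- the series of `λ^{2n}(λ − λ_c) a²`
  have hS : HasSum (fun k => lam k ^ (2 * n) * ((lam k - lam j₀) * a k ^ 2)) (D - lam j₀ * N) := by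
    have := hD.sub (hN.mul_left (lam j₀))
    refine this.congr_fun fun k => ?_; ring
  -- tail beyond m₂ is ≤ 0
  have htail := tail_nonpos hS m₂ fun k hk => by
    have hkc : lam k ≤ lam j₀ := hanti (h2.le.trans hk)
    exact mul_nonpos_iff.2 (Or.inl ⟨pow_nonneg (hnn k) _, mul_nonpos_iff.2 (Or.inr ⟨by linarith, sq_nonneg _⟩)⟩)
  -- finite part: split `range m₂ = range m₁ ∪ Ico m₁ m₂`
  have hsplit : ∑ k ∈ range m₂, lam k ^ (2 * n) * ((lam k - lam j₀) * a k ^ 2) =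
      ∑ k ∈ range m₁, lam k ^ (2 * n) * ((lam k - lam j₀) * a k ^ 2) + ∑ k ∈ Ico m₁ m₂, lam k ^ (2 * n) * ((lam k - lam j₀) * a k ^ 2) := by
    rw [← Finset.sum_range_add_sum_Ico _ (h1.trans h2.le)]
  have hlo : ∑ k ∈ range m₁, lam k ^ (2 * n) * ((lam k - lam j₀) * a k ^ 2) ≤ lam 0 ^ (2 * n) * (lam 0 - lam j₀) * ∑ k ∈ range m₁, a k ^ 2 := by
    rw [Finset.mul_sum]
    refine Finset.sum_le_sum fun k hk => ?_
    have hk0 : lam k ≤ lam 0 := hanti (Nat.zero_le k)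
    have hkc : lam j₀ ≤ lam k := hanti ((mem_range.1 hk).le.trans h1)
    calc lam k ^ (2 * n) * ((lam k - lam j₀) * a k ^ 2) ≤ lam 0 ^ (2 * n) * ((lam 0 - lam j₀) * a k ^ 2) :=
          mul_le_mul (pow_le_pow_left₀ (hnn k) hk0 _) (mul_le_mul_of_nonneg_right (by linarith) (sq_nonneg _))
            (mul_nonneg (by linarith) (sq_nonneg _)) (pow_nonneg (hnn 0) _)
      _ = lam 0 ^ (2 * n) * (lam 0 - lam j₀) * a k ^ 2 := by ring
  have hin : ∑ k ∈ Ico m₁ m₂, lam k ^ (2 * n) * ((lam k - lam j₀) * a k ^ 2) ≤ lam m₁ ^ (2 * n) * σ * ∑ k ∈ Ico m₁ m₂, a k ^ 2 := by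
    rw [Finset.mul_sum]
    refine Finset.sum_le_sum fun k hk => ?_
    obtain ⟨hk1, hk2⟩ := mem_Ico.1 hk
    have hkm : lam k ≤ lam m₁ := hanti hk1
    have hs := (abs_le.1 (hσ k hk1 hk2)).2
    calc lam k ^ (2 * n) * ((lam k - lam j₀) * a k ^ 2) ≤ lam k ^ (2 * n) * (σ * a k ^ 2) :=
          mul_le_mul_of_nonneg_left (mul_le_mul_of_nonneg_right hs (sq_nonneg _)) (pow_nonneg (hnn k) _)
      _ ≤ lam m₁ ^ (2 * n) * (σ * a k ^ 2) := by
          have hσ0 : 0 ≤ σ := (abs_nonneg _).trans (hσ k hk1 hk2)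
          exact mul_le_mul_of_nonneg_right (pow_le_pow_left₀ (hnn k) hkm _) (mul_nonneg hσ0 (sq_nonneg _))
      _ = lam m₁ ^ (2 * n) * σ * a k ^ 2 := by ring
  linarith [htail, hsplit, hlo, hin]

/-- ★ **Lower position budget.**  `λ_c N − D ≤ λ_{m₁}^{2n}·σ·in + λ_{m₂}^{2n}·(E + (λ_0 − λ_c)·lo + σ·in)` with `E = λ_c·nv − qv`, `nv ≥ Σ a²` (Bessel), `qv = Σ λ a²`.
[cite: ReedSimonIV1978, Thm. XIII.1] -/
theorem dressed_lower (hanti : Antitone lam) (hnn : ∀ k, 0 ≤ lam k) (n : ℕ) {m₁ m₂ j₀ : ℕ} (h1 : m₁ ≤ j₀) (h2 : j₀ < m₂)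
    {σ : ℝ} (hσ : ∀ k, m₁ ≤ k → k < m₂ → |lam k - lam j₀| ≤ σ) {N D A nv qv : ℝ}
    (hN : HasSum (fun k => lam k ^ (2 * n) * a k ^ 2) N) (hD : HasSum (fun k => lam k ^ (2 * n + 1) * a k ^ 2) D)
    (hA : HasSum (fun k => a k ^ 2) A) (hAnv : A ≤ nv) (hq : HasSum (fun k => lam k * a k ^ 2) qv) :
    lam j₀ * N - D ≤ lam m₁ ^ (2 * n) * σ * ∑ k ∈ Ico m₁ m₂, a k ^ 2 +
      lam m₂ ^ (2 * n) * ((lam j₀ * nv - qv) + (lam 0 - lam j₀) * ∑ k ∈ range m₁, a k ^ 2 + σ * ∑ k ∈ Ico m₁ m₂, a k ^ 2) := by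
  set κ := lam j₀ with hκ
  have hκm : lam m₂ ≤ κ := hanti h2.le
  -- series of `λ^{2n}(κ − λ)a²` (value κN − D) and of `(κ − λ)a²` (value κA − qv)
  have hSp : HasSum (fun k => lam k ^ (2 * n) * ((κ - lam k) * a k ^ 2)) (κ * N - D) := by
    have := (hN.mul_left κ).sub hD
    refine this.congr_fun fun k => ?_; ring
  have hS0 : HasSum (fun k => (κ - lam k) * a k ^ 2) (κ * A - qv) := by
    have := (hA.mul_left κ).sub hq
    refine this.congr_fun fun k => ?_; ring
  have htail := energy_tail_le hanti hnn (2 * n) m₂ hκm hSp hS0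
  -- finite parts
  have hsplit1 : ∑ k ∈ range m₂, lam k ^ (2 * n) * ((κ - lam k) * a k ^ 2) =
      ∑ k ∈ range m₁, lam k ^ (2 * n) * ((κ - lam k) * a k ^ 2) + ∑ k ∈ Ico m₁ m₂, lam k ^ (2 * n) * ((κ - lam k) * a k ^ 2) := by
    rw [← Finset.sum_range_add_sum_Ico _ (h1.trans h2.le)]
  have hsplit0 : ∑ k ∈ range m₂, (κ - lam k) * a k ^ 2 =
      ∑ k ∈ range m₁, (κ - lam k) * a k ^ 2 + ∑ k ∈ Ico m₁ m₂, (κ - lam k) * a k ^ 2 := by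
    rw [← Finset.sum_range_add_sum_Ico _ (h1.trans h2.le)]
  have hσ0 : ∀ k, m₁ ≤ k → k < m₂ → 0 ≤ σ := fun k hk1 hk2 => (abs_nonneg _).trans (hσ k hk1 hk2)
  -- low part of the dressed series is ≤ 0
  have hlo1 : ∑ k ∈ range m₁, lam k ^ (2 * n) * ((κ - lam k) * a k ^ 2) ≤ 0 :=
    Finset.sum_nonpos fun k hk => by
      have hkc : κ ≤ lam k := hanti ((mem_range.1 hk).le.trans h1)
      exact mul_nonpos_iff.2 (Or.inl ⟨pow_nonneg (hnn k) _, mul_nonpos_iff.2 (Or.inr ⟨by linarith, sq_nonneg _⟩)⟩)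
  -- cluster part of the dressed series
  have hin1 : ∑ k ∈ Ico m₁ m₂, lam k ^ (2 * n) * ((κ - lam k) * a k ^ 2) ≤ lam m₁ ^ (2 * n) * σ * ∑ k ∈ Ico m₁ m₂, a k ^ 2 := by
    rw [Finset.mul_sum]
    refine Finset.sum_le_sum fun k hk => ?_
    obtain ⟨hk1, hk2⟩ := mem_Ico.1 hk
    have hs := (abs_le.1 (hσ k hk1 hk2)).1
    calc lam k ^ (2 * n) * ((κ - lam k) * a k ^ 2) ≤ lam k ^ (2 * n) * (σ * a k ^ 2) :=
          mul_le_mul_of_nonneg_left (mul_le_mul_of_nonneg_right (by linarith) (sq_nonneg _)) (pow_nonneg (hnn k) _)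
      _ ≤ lam m₁ ^ (2 * n) * (σ * a k ^ 2) :=
          mul_le_mul_of_nonneg_right (pow_le_pow_left₀ (hnn k) (hanti hk1) _) (mul_nonneg (hσ0 k hk1 hk2) (sq_nonneg _))
      _ = lam m₁ ^ (2 * n) * σ * a k ^ 2 := by ring
  -- minus the low part of the undressed series: `−Σ_{k<m₁}(κ−λ_k)a² = Σ (λ_k − κ) a² ≤ (λ_0 − κ) lo`
  have hlo0 : -(∑ k ∈ range m₁, (κ - lam k) * a k ^ 2) ≤ (lam 0 - κ) * ∑ k ∈ range m₁, a k ^ 2 := by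
    rw [← Finset.sum_neg_distrib, Finset.mul_sum]
    refine Finset.sum_le_sum fun k _ => ?_
    have hk0 : lam k ≤ lam 0 := hanti (Nat.zero_le k)
    nlinarith [sq_nonneg (a k)]
  have hin0 : -(∑ k ∈ Ico m₁ m₂, (κ - lam k) * a k ^ 2) ≤ σ * ∑ k ∈ Ico m₁ m₂, a k ^ 2 := by
    rw [← Finset.sum_neg_distrib, Finset.mul_sum]
    refine Finset.sum_le_sum fun k hk => ?_
    obtain ⟨hk1, hk2⟩ := mem_Ico.1 hk
    have hs := (abs_le.1 (hσ k hk1 hk2)).2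
    nlinarith [sq_nonneg (a k)]
  -- undressed energy tail ≤ E + (λ_0−κ) lo + σ in
  have hκ0 : 0 ≤ κ := hnn j₀
  have hm2 : 0 ≤ lam m₂ ^ (2 * n) := pow_nonneg (hnn m₂) _
  have hE : κ * A - qv - ∑ k ∈ range m₂, (κ - lam k) * a k ^ 2 ≤
      (κ * nv - qv) + (lam 0 - κ) * ∑ k ∈ range m₁, a k ^ 2 + σ * ∑ k ∈ Ico m₁ m₂, a k ^ 2 := by
    rw [hsplit0]
    nlinarith [mul_le_mul_of_nonneg_left hAnv hκ0, hlo0, hin0]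
  have := mul_le_mul_of_nonneg_left hE hm2
  linarith [htail, hsplit1, hlo1, hin1, this]

/-- In-cluster mass controls the dressed norm from below: `λ_low^{2n}·in ≤ N` (`0 ≤ λ_low ≤ λ_k` on the cluster). [folklore] -/
theorem dressed_norm_lower (hnn : ∀ k, 0 ≤ lam k) (n : ℕ) {m₁ m₂ : ℕ} {lamlow : ℝ} (hlow0 : 0 ≤ lamlow)
    (hlow : ∀ k, m₁ ≤ k → k < m₂ → lamlow ≤ lam k) {N : ℝ} (hN : HasSum (fun k => lam k ^ (2 * n) * a k ^ 2) N) :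
    lamlow ^ (2 * n) * ∑ k ∈ Ico m₁ m₂, a k ^ 2 ≤ N := by
  have h1 : ∑ k ∈ range m₂, lam k ^ (2 * n) * a k ^ 2 ≤ N :=
    sum_le_of_hasSum hN (fun k => mul_nonneg (pow_nonneg (hnn k) _) (sq_nonneg _)) m₂
  have h2 : ∑ k ∈ Ico m₁ m₂, lam k ^ (2 * n) * a k ^ 2 ≤ ∑ k ∈ range m₂, lam k ^ (2 * n) * a k ^ 2 :=
    Finset.sum_le_sum_of_subset_of_nonneg (fun k hk => mem_range.2 (mem_Ico.1 hk).2)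
      fun k _ _ => mul_nonneg (pow_nonneg (hnn k) _) (sq_nonneg _)
  have h3 : lamlow ^ (2 * n) * ∑ k ∈ Ico m₁ m₂, a k ^ 2 ≤ ∑ k ∈ Ico m₁ m₂, lam k ^ (2 * n) * a k ^ 2 := by
    rw [Finset.mul_sum]
    exact Finset.sum_le_sum fun k hk => by
      obtain ⟨hk1, hk2⟩ := mem_Ico.1 hk
      exact mul_le_mul_of_nonneg_right (pow_le_pow_left₀ hlow0 (hlow k hk1 hk2) _) (sq_nonneg _)
  linarith

/-- The dressed norm is at most `λ_0^{2n}` times the undressed one. [folklore] -/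
theorem dressed_norm_upper (hanti : Antitone lam) (hnn : ∀ k, 0 ≤ lam k) (n : ℕ) {N A nv : ℝ}
    (hN : HasSum (fun k => lam k ^ (2 * n) * a k ^ 2) N) (hA : HasSum (fun k => a k ^ 2) A) (hAnv : A ≤ nv) :
    N ≤ lam 0 ^ (2 * n) * nv := by
  have h := hasSum_le (fun k => mul_le_mul_of_nonneg_right (pow_le_pow_left₀ (hnn k) (hanti (Nat.zero_le k)) (2 * n)) (sq_nonneg (a k)))
    hN (hA.mul_left (lam 0 ^ (2 * n)))
  exact h.trans (mul_le_mul_of_nonneg_left hAnv (pow_nonneg (hnn 0) _))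

/-! ## §2 Cross budgets -/

/-- ★ **Cross coupling budget.**  For two vectors with coefficients `a`, `b`, a cut `M` and a pivot `κ ≥ λ_M`, any `t > 0`:
`|(D_{ab} − κ N_{ab}) − Σ_{k<M} λ_k^{2n}(λ_k − κ)a_kb_k| ≤ λ_M^{2n}·(t·T_a + T_b/t)/2` where `T_a = (κA_a − q_a) − Σ_{k<M}(κ − λ_k)a_k²` is the undressed
energy tail (and `≤ (κ·nv_a − q_a) + Σ_{k<M}(λ_k − κ)a_k²` when `κ ≥ 0`, `A_a ≤ nv_a`). [folklore] -/
theorem dressed_cross (hanti : Antitone lam) (hnn : ∀ k, 0 ≤ lam k) (n M : ℕ) {κ : ℝ} (hκ : lam M ≤ κ) {t : ℝ} (ht : 0 < t)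
    {Nab Dab Aa Ab qa qb : ℝ}
    (hNab : HasSum (fun k => lam k ^ (2 * n) * (a k * b k)) Nab) (hDab : HasSum (fun k => lam k ^ (2 * n + 1) * (a k * b k)) Dab)
    (hAa : HasSum (fun k => a k ^ 2) Aa) (hAb : HasSum (fun k => b k ^ 2) Ab)
    (hqa : HasSum (fun k => lam k * a k ^ 2) qa) (hqb : HasSum (fun k => lam k * b k ^ 2) qb) :
    |(Dab - κ * Nab) - ∑ k ∈ range M, lam k ^ (2 * n) * ((lam k - κ) * (a k * b k))| ≤
      lam M ^ (2 * n) * ((t * ((κ * Aa - qa) - ∑ k ∈ range M, (κ - lam k) * a k ^ 2) +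
        ((κ * Ab - qb) - ∑ k ∈ range M, (κ - lam k) * b k ^ 2) / t) / 2) := by
  have hSab : HasSum (fun k => lam k ^ (2 * n) * ((κ - lam k) * (a k * b k))) (κ * Nab - Dab) := by
    have := (hNab.mul_left κ).sub hDab
    refine this.congr_fun fun k => ?_; ring
  have hSa : HasSum (fun k => (κ - lam k) * a k ^ 2) (κ * Aa - qa) := by
    have := (hAa.mul_left κ).sub hqa
    refine this.congr_fun fun k => ?_; ring
  have hSb : HasSum (fun k => (κ - lam k) * b k ^ 2) (κ * Ab - qb) := by
    have := (hAb.mul_left κ).sub hqb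
    refine this.congr_fun fun k => ?_; ring
  have h := cross_tail_le hanti hnn (2 * n) M hκ ht hSab hSa hSb
  have e : (Dab - κ * Nab) - ∑ k ∈ range M, lam k ^ (2 * n) * ((lam k - κ) * (a k * b k)) =
      -((κ * Nab - Dab) - ∑ k ∈ range M, lam k ^ (2 * n) * ((κ - lam k) * (a k * b k))) := by
    rw [neg_sub, sub_eq_iff_eq_add]
    have : ∑ k ∈ range M, lam k ^ (2 * n) * ((lam k - κ) * (a k * b k)) = -∑ k ∈ range M, lam k ^ (2 * n) * ((κ - lam k) * (a k * b k)) := by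
      rw [← Finset.sum_neg_distrib]; refine sum_congr rfl fun k _ => ?_; ring
    rw [this]; ring
  rw [e, abs_neg]
  exact h

end Summit.QuantumFields.YangMills.Theorems.FemtoTransferGap.SpecSum

end
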